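import Summits.HubbardSuperconductivity.HubbardSuperconductivity.Theorems.NodalDiracTwistNodalDiracWeakCouplingOfConicalCore
import Summits.HubbardSuperconductivity.HubbardSuperconductivity.Theorems.NodalDiracTwistBridgeNodalToDWaveDiagonalParitySegment
import Summits.HubbardSuperconductivity.HubbardSuperconductivity.Theorems.NodalDiracTwistNodalDiracWeakCouplingSignOfParityFlip
import Summits.HubbardSuperconductivity.HubbardSuperconductivity.Theorems.NodalDiracTwistNodalDiracWeakCouplingMeshCoarsening
import Summits.HubbardSuperconductivity.HubbardSuperconductivity.Theorems.NodalDiracTwistNodalDiracWeakCouplingRotLoopTransport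

/-!
# The crux from LOCUS + the parity flip (crux `NodalDiracWeakCoupling`, line `birth` v9)

Route `HubbardSuperconductivity/NodalDiracTwist`, crux stmt-HubbardSuperconductivity-10370
(`NodalDiracWeakCoupling`), skeleton `Cruxes/NodalDiracWeakCoupling/Lines/birth.lean` v9
("the sign is forced by the parity flip", Longuet-Higgins read backwards through the `x₀ ↔ x₁`
mirror). The sorry-free COMPOSITION of the skeleton: the crux follows from `stub_locusParity`,

* LOCUS on the closed triangle `0 ≤ φ₁ ≤ φ₀ ≤ π` (the `(N_L, S^z = 0)`-sector ground state of
  `H_L(U, φ) = spinTwistedHubbardTorus L U φ` admits an orthogonal pair iff `φ = (c, c)`), and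
* NC1: sector ground states of `H_L(U, (0,0))` and of `H_L(U, (π,π))` (periodic versus doubly
  antiperiodic boundary conditions, up to the spin gauge) are eigenvectors of the swap
  `U_{sr 3} = fockD4 (sr 3)` with OPPOSITE signs,

using only landed mathematics (`deg_abs_iff`, `deg_swap_iff`, `swapSign_const_on_diagonal_segment`,
`stub_signOfParityFlip`, `stub_meshCoarsening`, `stub_rotLoopTransport`). Main results:
`sign_from_parity` (LOCUS on the cell + NC1 ⇒ the SIGN clause at all four points, all radii
`r < min(c, π − c)`) and `nodalDiracWeakCoupling_of_locusParity`. The converse (crux ⇒ LOCUS ∧ NC1)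
is the landed `stub_swapParityZeroVsPi`, so the crux is EQUIVALENT to LOCUS ∧ NC1.

## References

H. C. Longuet-Higgins, Proc. R. Soc. A 344 (1975) 147; Y. Hatsugai, J. Phys. Soc. Jpn. 75 (2006)
123601; T. Fukui, Y. Hatsugai, H. Suzuki, J. Phys. Soc. Jpn. 74 (2005) 1674; D. J. Scalapino,
Phys. Rep. 250 (1995) 329, §2. No new definitions, no named facts.
-/

-- the mandated namespace repeats `HubbardSuperconductivity` (single-problem summit, D-0017)
set_option linter.dupNamespace false

noncomputable section

namespace Summit.HubbardSuperconductivity.HubbardSuperconductivity.Theorems.NodalDiracTwist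

open Literature.MathematicalPhysics.QuantumLattice Literature.Probability.LatticeModels Matrix
open Summit.HubbardSuperconductivity.HubbardSuperconductivity.Theses.NodalDiracTwist
open Summit.HubbardSuperconductivity.HubbardSuperconductivity.Theorems.NodalDiracTwist.BridgeNodalToDWave
open scoped BigOperators ComplexOrder Matrix

section Model

variable (L : ℕ) [NeZero L] (U : ℝ) (N : ℕ)

/-- **Rotating the SIGN clause.** If the sector ground state of `H_L(U, ·)` is unique up to scalars
on the circle of radius `r > 0` about the rotated centre `(−p₁, p₀)` and the cyclic overlap
products on all fine meshes about `p` are negative, then so are those about `(−p₁, p₀)`: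
refine to a mesh divisible by `4` (`stub_meshCoarsening`, `k = 4`) and rotate
(`stub_rotLoopTransport`). Scalapino (1995) §2; Fukui–Hatsugai–Suzuki (2005). [folklore] -/
theorem negLoop_rot_eventually {p : Fin 2 → ℝ} {r : ℝ} (hr : 0 < r)
    (hu : ∀ φ : Fin 2 → ℝ, (φ 0 - (![-p 1, p 0] : Fin 2 → ℝ) 0) ^ 2 +
        (φ 1 - (![-p 1, p 0] : Fin 2 → ℝ) 1) ^ 2 = r ^ 2 →
      ∀ χ₁ χ₂ : Fock (Orb (FermionTorus 2 L)),
        IsGroundStateInSector (spinTwistedHubbardTorus L U φ) N 0 χ₁ →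
        IsGroundStateInSector (spinTwistedHubbardTorus L U φ) N 0 χ₂ → ∃ z : ℂ, χ₂ = z • χ₁)
    (h : ∃ n₀ : ℕ, ∀ n ≥ n₀, ∀ ψ : Fin n → Fock (Orb (FermionTorus 2 L)),
      (∀ i : Fin n,
        IsGroundStateInSector (spinTwistedHubbardTorus L U
            (fun ν : Fin 2 => p ν + r *
                  (if ν = 0 then Real.cos (2 * Real.pi * (i : ℕ) / n)
                    else Real.sin (2 * Real.pi * (i : ℕ) / n)))) N 0 (ψ i) ∧
          star (ψ i) ⬝ᵥ ψ i = 1) →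
      (∏ i : Fin n, star (ψ i) ⬝ᵥ ψ (finRotate n i)).re < 0) :
    ∃ n₀ : ℕ, ∀ n ≥ n₀, ∀ ψ : Fin n → Fock (Orb (FermionTorus 2 L)),
      (∀ i : Fin n,
        IsGroundStateInSector (spinTwistedHubbardTorus L U
            (fun ν : Fin 2 => (![-p 1, p 0] : Fin 2 → ℝ) ν + r *
                  (if ν = 0 then Real.cos (2 * Real.pi * (i : ℕ) / n)
                    else Real.sin (2 * Real.pi * (i : ℕ) / n)))) N 0 (ψ i) ∧
          star (ψ i) ⬝ᵥ ψ i = 1) →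
      (∏ i : Fin n, star (ψ i) ⬝ᵥ ψ (finRotate n i)).re < 0 := by
  obtain ⟨n₀, hn₀⟩ := h
  obtain ⟨n₁, hn₁⟩ := stub_meshCoarsening L U N ![-p 1, p 0] r hr hu
  refine ⟨max n₀ n₁, fun n hn => ?_⟩
  have h0 : n₀ ≤ n := le_trans (le_max_left _ _) hn
  exact hn₁ n (le_trans (le_max_right _ _) hn) 4 (by norm_num)
    (stub_rotLoopTransport L U N p r (4 * n) (dvd_mul_right 4 n) (hn₀ (4 * n) (by omega)))

/-- **LOCUS on the cell from LOCUS on the triangle** (the `D₄` reduction of the degeneracy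
predicate, as in `conicalQuartet_of_core`: the predicate is invariant under `φ_μ ↦ -φ_μ` and the
swap, `deg_abs_iff`, `deg_swap_iff`). Scalapino (1995) §2. [folklore] -/
theorem locus_cell_of_triangle (c : ℝ)
    (hlocus : ∀ φ : Fin 2 → ℝ, 0 ≤ φ 1 → φ 1 ≤ φ 0 → φ 0 ≤ Real.pi →
      ((∃ ψ₁ ψ₂ : Fock (Orb (FermionTorus 2 L)),
          IsGroundStateInSector (spinTwistedHubbardTorus L U φ) N 0 ψ₁ ∧
          IsGroundStateInSector (spinTwistedHubbardTorus L U φ) N 0 ψ₂ ∧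
          star ψ₁ ⬝ᵥ ψ₂ = 0) ↔ (φ 0 = c ∧ φ 1 = c))) :
    ∀ φ : Fin 2 → ℝ, φ 0 ∈ Set.Ioc (-Real.pi) Real.pi → φ 1 ∈ Set.Ioc (-Real.pi) Real.pi →
      ((∃ ψ₁ ψ₂ : Fock (Orb (FermionTorus 2 L)),
          IsGroundStateInSector (spinTwistedHubbardTorus L U φ) N 0 ψ₁ ∧
          IsGroundStateInSector (spinTwistedHubbardTorus L U φ) N 0 ψ₂ ∧
          star ψ₁ ⬝ᵥ ψ₂ = 0) ↔ (|φ 0| = c ∧ |φ 1| = c)) := by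
  intro φ hφ0 hφ1
  have ha : |φ 0| ≤ Real.pi := abs_le.2 ⟨by linarith [hφ0.1], hφ0.2⟩
  have hb : |φ 1| ≤ Real.pi := abs_le.2 ⟨by linarith [hφ1.1], hφ1.2⟩
  rw [← deg_abs_iff L U N φ]
  rcases le_total (|φ 1|) (|φ 0|) with hle | hle
  · have key := hlocus ![|φ 0|, |φ 1|] (by simp) (by simpa using hle) (by simpa using ha)
    simp only [Matrix.cons_val_zero, Matrix.cons_val_one] at key
    exact key
  · have hsw := deg_swap_iff L U N ![|φ 0|, |φ 1|]
    simp only [Matrix.cons_val_zero, Matrix.cons_val_one] at hsw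
    rw [← hsw]
    have key := hlocus ![|φ 1|, |φ 0|] (by simp) (by simpa using hle) (by simpa using hb)
    simp only [Matrix.cons_val_zero, Matrix.cons_val_one] at key
    rw [key]
    exact and_comm

/-- **Uniqueness off the locus.** Under LOCUS on the cell, at a twist of the cell which is not one
of the four points `(±c, ±c)` any two sector ground states are parallel (Gram–Schmidt in the sector
eigenspace, `unique_of_no_orthogonal_pair`). Lieb, PRL 62 (1989) 1201 (sectors). [folklore] -/
theorem uniq_of_locus (c : ℝ)
    (hlocus : ∀ φ : Fin 2 → ℝ, φ 0 ∈ Set.Ioc (-Real.pi) Real.pi →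
      φ 1 ∈ Set.Ioc (-Real.pi) Real.pi →
        ((∃ ψ₁ ψ₂ : Fock (Orb (FermionTorus 2 L)),
            IsGroundStateInSector (spinTwistedHubbardTorus L U φ) N 0 ψ₁ ∧
            IsGroundStateInSector (spinTwistedHubbardTorus L U φ) N 0 ψ₂ ∧
            star ψ₁ ⬝ᵥ ψ₂ = 0) ↔ (|φ 0| = c ∧ |φ 1| = c)))
    (φ : Fin 2 → ℝ) (hφ0 : φ 0 ∈ Set.Ioc (-Real.pi) Real.pi) (hφ1 : φ 1 ∈ Set.Ioc (-Real.pi) Real.pi)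
    (hnot : ¬ (|φ 0| = c ∧ |φ 1| = c)) :
    ∀ χ₁ χ₂ : Fock (Orb (FermionTorus 2 L)),
      IsGroundStateInSector (spinTwistedHubbardTorus L U φ) N 0 χ₁ →
      IsGroundStateInSector (spinTwistedHubbardTorus L U φ) N 0 χ₂ → ∃ z : ℂ, χ₂ = z • χ₁ :=
  fun χ₁ χ₂ h₁ h₂ =>
    unique_of_no_orthogonal_pair (fun hex => hnot ((hlocus φ hφ0 hφ1).1 hex)) χ₁ χ₂ h₁ h₂

/-- **Uniqueness on the circles about a locus point.** Under LOCUS on the cell with `0 < c < π`,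
for a locus point `p = (±c, ±c)` and `0 < r < min(c, π - c)` the sector ground state is unique up
to scalars on the circle `|φ - p| = r` (plane geometry: the circle lies in the open cell and
avoids the locus). [folklore] -/
theorem uniqCircle_of_locus {c : ℝ} (hc0 : 0 < c)
    (hlocus : ∀ φ : Fin 2 → ℝ, φ 0 ∈ Set.Ioc (-Real.pi) Real.pi →
      φ 1 ∈ Set.Ioc (-Real.pi) Real.pi →
        ((∃ ψ₁ ψ₂ : Fock (Orb (FermionTorus 2 L)),
            IsGroundStateInSector (spinTwistedHubbardTorus L U φ) N 0 ψ₁ ∧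
            IsGroundStateInSector (spinTwistedHubbardTorus L U φ) N 0 ψ₂ ∧
            star ψ₁ ⬝ᵥ ψ₂ = 0) ↔ (|φ 0| = c ∧ |φ 1| = c)))
    (p : Fin 2 → ℝ) (hp0 : |p 0| = c) (hp1 : |p 1| = c) {r : ℝ} (hr : 0 < r)
    (hrlt : r < min c (Real.pi - c)) :
    ∀ φ : Fin 2 → ℝ, (φ 0 - p 0) ^ 2 + (φ 1 - p 1) ^ 2 = r ^ 2 →
      ∀ χ₁ χ₂ : Fock (Orb (FermionTorus 2 L)),
        IsGroundStateInSector (spinTwistedHubbardTorus L U φ) N 0 χ₁ →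
        IsGroundStateInSector (spinTwistedHubbardTorus L U φ) N 0 χ₂ → ∃ z : ℂ, χ₂ = z • χ₁ := by
  intro φ hφ χ₁ χ₂ hχ₁ hχ₂
  have hrc : r < c := lt_of_lt_of_le hrlt (min_le_left _ _)
  have hrπ : r < Real.pi - c := lt_of_lt_of_le hrlt (min_le_right _ _)
  have key : ∀ a q : ℝ, |q| = c → (a - q) ^ 2 ≤ r ^ 2 →
      a ∈ Set.Ioc (-Real.pi) Real.pi ∧ (|a| = c → a = q) := by
    intro a q hq haq
    obtain ⟨h₁, h₂⟩ := abs_le_of_sq_le_sq' haq hr.le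
    rcases (abs_eq hc0.le).1 hq with rfl | rfl
    · refine ⟨⟨by linarith, by linarith⟩, fun ha => ?_⟩
      rcases (abs_eq hc0.le).1 ha with h | h
      · exact h
      · exfalso; linarith
    · refine ⟨⟨by linarith, by linarith⟩, fun ha => ?_⟩
      rcases (abs_eq hc0.le).1 ha with h | h
      · exfalso; linarith
      · exact h
  have h0sq : (φ 0 - p 0) ^ 2 ≤ r ^ 2 := by nlinarith [sq_nonneg (φ 1 - p 1)]
  have h1sq : (φ 1 - p 1) ^ 2 ≤ r ^ 2 := by nlinarith [sq_nonneg (φ 0 - p 0)]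
  obtain ⟨hφ0, he0⟩ := key (φ 0) (p 0) hp0 h0sq
  obtain ⟨hφ1, he1⟩ := key (φ 1) (p 1) hp1 h1sq
  have hnot : ¬ (|φ 0| = c ∧ |φ 1| = c) := by
    rintro ⟨ha0, ha1⟩
    have e0 := he0 ha0
    have e1 := he1 ha1
    rw [e0, e1, sub_self, sub_self, zero_pow two_ne_zero, add_zero] at hφ
    exact absurd hφ.symm (ne_of_gt (pow_pos hr 2))
  exact uniq_of_locus L U N c hlocus φ hφ0 hφ1 hnot χ₁ χ₂ hχ₁ hχ₂

/-- **SIGN at the distinguished point `(c, c)` from the parity flip.** Under LOCUS on the cell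
(`0 < c < π`) and NC1, for every `0 < r < min(c, π - c)` the cyclic overlap products on all fine
meshes of the circle of radius `r` about `(c, c)` and all unit ground-state choices are negative:
the swap sign is constant on the diagonal segments `[0, c - r/√2]` and `[c + r/√2, π]`
(`swapSign_const_on_diagonal_segment`), so NC1 gives opposite signs at the two diagonal vertices of
the circle; `stub_signOfParityFlip` gives the `8m`-gons and `stub_meshCoarsening` every `n ≥ n₀`.
Longuet-Higgins (1975); Hatsugai (2006). [folklore] -/
theorem negLoop_diag_of_parity {c : ℝ} (hc0 : 0 < c) (hcπ : c < Real.pi)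
    (hlocus : ∀ φ : Fin 2 → ℝ, φ 0 ∈ Set.Ioc (-Real.pi) Real.pi →
      φ 1 ∈ Set.Ioc (-Real.pi) Real.pi →
        ((∃ ψ₁ ψ₂ : Fock (Orb (FermionTorus 2 L)),
            IsGroundStateInSector (spinTwistedHubbardTorus L U φ) N 0 ψ₁ ∧
            IsGroundStateInSector (spinTwistedHubbardTorus L U φ) N 0 ψ₂ ∧
            star ψ₁ ⬝ᵥ ψ₂ = 0) ↔ (|φ 0| = c ∧ |φ 1| = c)))
    (hNC1 : ∃ χ₀ χπ : Fock (Orb (FermionTorus 2 L)),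
      IsGroundStateInSector (spinTwistedHubbardTorus L U (fun _ : Fin 2 => (0 : ℝ))) N 0 χ₀ ∧
      IsGroundStateInSector (spinTwistedHubbardTorus L U (fun _ : Fin 2 => Real.pi)) N 0 χπ ∧
      (((@fockD4 L _ (DihedralGroup.sr 3)).val *ᵥ χ₀ = χ₀ ∧
          (@fockD4 L _ (DihedralGroup.sr 3)).val *ᵥ χπ = -χπ) ∨
        ((@fockD4 L _ (DihedralGroup.sr 3)).val *ᵥ χ₀ = -χ₀ ∧
          (@fockD4 L _ (DihedralGroup.sr 3)).val *ᵥ χπ = χπ)))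
    {r : ℝ} (hr : 0 < r) (hrlt : r < min c (Real.pi - c)) :
    ∃ n₀ : ℕ, ∀ n ≥ n₀, ∀ ψ : Fin n → Fock (Orb (FermionTorus 2 L)),
      (∀ i : Fin n,
        IsGroundStateInSector (spinTwistedHubbardTorus L U
            (fun ν : Fin 2 => (fun _ : Fin 2 => c) ν + r *
                  (if ν = 0 then Real.cos (2 * Real.pi * (i : ℕ) / n)
                    else Real.sin (2 * Real.pi * (i : ℕ) / n)))) N 0 (ψ i) ∧
          star (ψ i) ⬝ᵥ ψ i = 1) →
      (∏ i : Fin n, star (ψ i) ⬝ᵥ ψ (finRotate n i)).re < 0 := by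
  classical
  have hrc : r < c := lt_of_lt_of_le hrlt (min_le_left _ _)
  have hrπ : r < Real.pi - c := lt_of_lt_of_le hrlt (min_le_right _ _)
  set p : Fin 2 → ℝ := fun _ => c with hpdef
  have hp0 : |p 0| = c := abs_of_pos hc0
  have hp1 : |p 1| = c := abs_of_pos hc0
  have hu := uniqCircle_of_locus L U N hc0 hlocus p hp0 hp1 hr hrlt
  -- trigonometry of the two diagonal vertices
  have hcos4 : Real.cos (Real.pi / 4) = Real.sqrt 2 / 2 := Real.cos_pi_div_four
  have hsin4 : Real.sin (Real.pi / 4) = Real.sqrt 2 / 2 := Real.sin_pi_div_four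
  have hcos5 : Real.cos (5 * Real.pi / 4) = -(Real.sqrt 2 / 2) := by
    rw [show 5 * Real.pi / 4 = Real.pi / 4 + Real.pi by ring, Real.cos_add_pi, hcos4]
  have hsin5 : Real.sin (5 * Real.pi / 4) = -(Real.sqrt 2 / 2) := by
    rw [show 5 * Real.pi / 4 = Real.pi / 4 + Real.pi by ring, Real.sin_add_pi, hsin4]
  have hs2' : Real.sqrt 2 / 2 < 1 := by
    rw [div_lt_one (by norm_num : (0:ℝ) < 2)]
    have h := Real.sqrt_lt_sqrt (by norm_num : (0:ℝ) ≤ 2) (by norm_num : (2:ℝ) < 4)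
    rwa [show (4:ℝ) = 2 ^ 2 by norm_num, Real.sqrt_sq (by norm_num : (0:ℝ) ≤ 2)] at h
  set tp : ℝ := c + r * (Real.sqrt 2 / 2) with htp
  set tm : ℝ := c - r * (Real.sqrt 2 / 2) with htm
  have hrs : r * (Real.sqrt 2 / 2) < r := by nlinarith
  have hrs0 : 0 < r * (Real.sqrt 2 / 2) := by positivity
  have htm0 : 0 ≤ tm := by rw [htm]; linarith
  have htmc : tm < c := by rw [htm]; linarith
  have htpc : c < tp := by rw [htp]; linarith
  have htpπ : tp ≤ Real.pi := by rw [htp]; linarith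
  have hvp : (fun ν : Fin 2 => p ν + r * (if ν = 0 then Real.cos (Real.pi / 4)
      else Real.sin (Real.pi / 4))) = fun _ : Fin 2 => tp := by
    funext ν; fin_cases ν <;> simp [hpdef, htp, hcos4, hsin4]
  have hvm : (fun ν : Fin 2 => p ν + r * (if ν = 0 then Real.cos (5 * Real.pi / 4)
      else Real.sin (5 * Real.pi / 4))) = fun _ : Fin 2 => tm := by
    funext ν; fin_cases ν <;> simp [hpdef, htm, hcos5, hsin5] <;> ring
  -- uniqueness along the two diagonal segments `[0, tm]` and `[tp, π]`
  have hdiag : ∀ t : ℝ, 0 ≤ t → t ≤ Real.pi → t ≠ c → ∀ χ₁ χ₂ : Fock (Orb (FermionTorus 2 L)),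
      IsGroundStateInSector (spinTwistedHubbardTorus L U (fun _ : Fin 2 => t)) N 0 χ₁ →
      IsGroundStateInSector (spinTwistedHubbardTorus L U (fun _ : Fin 2 => t)) N 0 χ₂ →
      ∃ z : ℂ, χ₂ = z • χ₁ := by
    intro t ht0 htπ htc
    have hπ := Real.pi_pos
    refine uniq_of_locus L U N c hlocus (fun _ : Fin 2 => t) ⟨by linarith, htπ⟩ ⟨by linarith, htπ⟩ ?_
    rintro ⟨h, -⟩
    exact htc (by rwa [abs_of_nonneg ht0] at h)
  obtain ⟨s₀, hs₀⟩ := swapSign_const_on_diagonal_segment L U N 0 tm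
    (fun t ht => hdiag t ht.1 (by linarith [ht.2]) (by linarith [ht.2]))
  obtain ⟨sπ, hsπ⟩ := swapSign_const_on_diagonal_segment L U N tp Real.pi
    (fun t ht => hdiag t (by linarith [ht.1]) ht.2 (by linarith [ht.1]))
  -- ground states at the two vertices (the sector is non-trivial)
  obtain ⟨χ₀, χπ, hχ₀, hχπ, hflip⟩ := hNC1
  have hK : (szSector N 0 : Submodule ℂ (Fock (Orb (FermionTorus 2 L)))) ≠ ⊥ :=
    (Submodule.ne_bot_iff _).2 ⟨χ₀, hχ₀.1, hχ₀.2.1⟩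
  have hex : ∀ φ : Fin 2 → ℝ, ∃ v : Fock (Orb (FermionTorus 2 L)),
      IsGroundStateInSector (spinTwistedHubbardTorus L U φ) N 0 v := fun φ => by
    obtain ⟨v, hv, h1, he⟩ := exists_unit_eigen_minEnergyOn
      (spinTwistedHubbardTorus_isHermitian L U φ) (szSector N 0)
      (fun v hv => spinTwistedHubbardTorus_mulVec_mem_szSector L U φ hv) hK
    exact ⟨v, hv, ne_zero_of_unit h1, he⟩
  obtain ⟨χp, hχp⟩ := hex (fun _ : Fin 2 => tp)
  obtain ⟨χm, hχm⟩ := hex (fun _ : Fin 2 => tm)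
  have hdp : (@fockD4 L _ (DihedralGroup.sr 3)).val *ᵥ χp = sπ • χp :=
    hsπ tp ⟨le_rfl, htpπ⟩ χp hχp
  have hdm : (@fockD4 L _ (DihedralGroup.sr 3)).val *ᵥ χm = s₀ • χm :=
    hs₀ tm ⟨htm0, le_rfl⟩ χm hχm
  have h0 : (@fockD4 L _ (DihedralGroup.sr 3)).val *ᵥ χ₀ = s₀ • χ₀ :=
    hs₀ 0 ⟨le_rfl, htm0⟩ χ₀ hχ₀
  have hπ' : (@fockD4 L _ (DihedralGroup.sr 3)).val *ᵥ χπ = sπ • χπ :=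
    hsπ Real.pi ⟨htpπ, le_rfl⟩ χπ hχπ
  -- the signs: `s₀ = ±1`, `sπ = ∓1`
  have hsolve : ∀ (χ : Fock (Orb (FermionTorus 2 L))) (s e : ℂ), χ ≠ 0 → s • χ = e • χ → s = e := by
    intro χ s e hχ h
    have h' : (s - e) • χ = 0 := by rw [sub_smul, h, sub_self]
    exact sub_eq_zero.1 ((smul_eq_zero.1 h').resolve_right hχ)
  have hre : (s₀ * star sπ).re < 0 := by
    rcases hflip with ⟨h0', hπ''⟩ | ⟨h0', hπ''⟩
    · have e0 : s₀ = 1 := hsolve χ₀ s₀ 1 hχ₀.2.1 (by rw [← h0, h0', one_smul])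
      have eπ : sπ = -1 := hsolve χπ sπ (-1) hχπ.2.1 (by rw [← hπ', hπ'', neg_one_smul])
      rw [e0, eπ]; norm_num
    · have e0 : s₀ = -1 := hsolve χ₀ s₀ (-1) hχ₀.2.1 (by rw [← h0, h0', neg_one_smul])
      have eπ : sπ = 1 := hsolve χπ sπ 1 hχπ.2.1 (by rw [← hπ', hπ'', one_smul])
      rw [e0, eπ]; norm_num
  -- the `8m`-gons
  have hχp' : IsGroundStateInSector (spinTwistedHubbardTorus L U (fun ν : Fin 2 => p ν +
      r * (if ν = 0 then Real.cos (Real.pi / 4) else Real.sin (Real.pi / 4)))) N 0 χp := by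
    rw [hvp]; exact hχp
  have hχm' : IsGroundStateInSector (spinTwistedHubbardTorus L U (fun ν : Fin 2 => p ν +
      r * (if ν = 0 then Real.cos (5 * Real.pi / 4) else Real.sin (5 * Real.pi / 4)))) N 0 χm := by
    rw [hvm]; exact hχm
  obtain ⟨m₀, hm₀⟩ := stub_signOfParityFlip L U N p rfl r hr hu χp χm sπ s₀ hχp' hdp hχm' hdm hre
  -- all fine meshes
  obtain ⟨n₁, hn₁⟩ := stub_meshCoarsening L U N p r hr hu
  refine ⟨max n₁ 1, fun n hn => ?_⟩
  have hn1 : n₁ ≤ n := le_trans (le_max_left _ _) hn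
  have hnpos : 1 ≤ n := le_trans (le_max_right _ _) hn
  refine hn₁ n hn1 (8 * max m₀ 1) (by positivity) ?_
  have hk : 8 * max m₀ 1 * n = 8 * (max m₀ 1 * n) := by ring
  rw [hk]
  exact hm₀ (max m₀ 1 * n) (le_trans (le_max_left m₀ 1) (Nat.le_mul_of_pos_right _ hnpos))

/-- **LOCUS (cell) + NC1 ⇒ the crux's SIGN clause at all four points** (the seam of skeleton v9):
at `(c, c)` by `negLoop_diag_of_parity`; the other three points `(−c, c)`, `(−c, −c)`, `(c, −c)`
are its images under the 90° rotation applied once, twice, thrice (`negLoop_rot_eventually`, with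
uniqueness on their circles from `uniqCircle_of_locus`). Longuet-Higgins (1975); Hatsugai (2006);
Scalapino (1995) §2. [folklore] -/
theorem sign_from_parity {c : ℝ} (hc0 : 0 < c) (hcπ : c < Real.pi)
    (hlocus : ∀ φ : Fin 2 → ℝ, φ 0 ∈ Set.Ioc (-Real.pi) Real.pi →
      φ 1 ∈ Set.Ioc (-Real.pi) Real.pi →
        ((∃ ψ₁ ψ₂ : Fock (Orb (FermionTorus 2 L)),
            IsGroundStateInSector (spinTwistedHubbardTorus L U φ) N 0 ψ₁ ∧
            IsGroundStateInSector (spinTwistedHubbardTorus L U φ) N 0 ψ₂ ∧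
            star ψ₁ ⬝ᵥ ψ₂ = 0) ↔ (|φ 0| = c ∧ |φ 1| = c)))
    (hNC1 : ∃ χ₀ χπ : Fock (Orb (FermionTorus 2 L)),
      IsGroundStateInSector (spinTwistedHubbardTorus L U (fun _ : Fin 2 => (0 : ℝ))) N 0 χ₀ ∧
      IsGroundStateInSector (spinTwistedHubbardTorus L U (fun _ : Fin 2 => Real.pi)) N 0 χπ ∧
      (((@fockD4 L _ (DihedralGroup.sr 3)).val *ᵥ χ₀ = χ₀ ∧
          (@fockD4 L _ (DihedralGroup.sr 3)).val *ᵥ χπ = -χπ) ∨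
        ((@fockD4 L _ (DihedralGroup.sr 3)).val *ᵥ χ₀ = -χ₀ ∧
          (@fockD4 L _ (DihedralGroup.sr 3)).val *ᵥ χπ = χπ))) :
    ∀ p : Fin 2 → ℝ, |p 0| = c → |p 1| = c → ∀ r : ℝ, 0 < r → r < min c (Real.pi - c) →
      ∃ n₀ : ℕ, ∀ n ≥ n₀, ∀ ψ : Fin n → Fock (Orb (FermionTorus 2 L)),
        (∀ i : Fin n,
          IsGroundStateInSector (spinTwistedHubbardTorus L U
              (fun ν : Fin 2 => p ν + r *
                    (if ν = 0 then Real.cos (2 * Real.pi * (i : ℕ) / n)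
                      else Real.sin (2 * Real.pi * (i : ℕ) / n)))) N 0 (ψ i) ∧
            star (ψ i) ⬝ᵥ ψ i = 1) →
        (∏ i : Fin n, star (ψ i) ⬝ᵥ ψ (finRotate n i)).re < 0 := by
  intro p hp0 hp1 r hr hrlt
  have hcc := negLoop_diag_of_parity L U N hc0 hcπ hlocus hNC1 hr hrlt
  have huq := fun (q : Fin 2 → ℝ) (hq0 : |q 0| = c) (hq1 : |q 1| = c) =>
    uniqCircle_of_locus L U N hc0 hlocus q hq0 hq1 hr hrlt
  have hac : |c| = c := abs_of_pos hc0
  have hanc : |-c| = c := by rw [abs_neg, hac]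
  -- the three rotated images of `(c, c)`
  have h1 := negLoop_rot_eventually L U N (p := fun _ : Fin 2 => c) hr
    (by simpa using huq ![-c, c] (by simp [hanc]) (by simp [hac])) hcc
  have h2 := negLoop_rot_eventually L U N (p := ![-c, c]) hr
    (by simpa using huq ![-c, -c] (by simp [hanc]) (by simp [hanc])) h1
  simp only [Matrix.cons_val_one, Matrix.cons_val_zero] at h2
  have h3 := negLoop_rot_eventually L U N (p := ![-c, -c]) hr
    (by simpa using huq ![c, -c] (by simp [hac]) (by simp [hanc])) h2
  simp only [Matrix.cons_val_one, Matrix.cons_val_zero, neg_neg] at h3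
  have hpc : p = ![p 0, p 1] := (twist_vec2_eta p).symm
  rcases (abs_eq hc0.le).1 hp0 with h0 | h0 <;> rcases (abs_eq hc0.le).1 hp1 with h1' | h1'
  · have hp : p = fun _ : Fin 2 => c := by funext i; fin_cases i <;> assumption
    subst hp
    exact hcc
  · have hp : p = ![c, -c] := by rw [hpc, h0, h1']
    rw [hp]; exact h3
  · have hp : p = ![-c, c] := by rw [hpc, h0, h1']
    rw [hp]; exact h1
  · have hp : p = ![-c, -c] := by rw [hpc, h0, h1']
    rw [hp]; exact h2

end Model

/-- **The crux reduces to LOCUS + the parity flip.** `NodalDiracWeakCoupling` (route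
NodalDiracTwist, stmt-HubbardSuperconductivity-10370) follows from the physics statement
`stub_locusParity` of the line `birth` v9: `(U, δ, κ, L₀, c)`, LOCUS on the fundamental triangle
`0 ≤ φ₁ ≤ φ₀ ≤ π` and NC1 (opposite swap parity of the sector ground states at the twists `(0,0)`
and `(π,π)`). The LOCUS clause of the crux is `locus_cell_of_triangle`, the SIGN clause is
`sign_from_parity`; the route's inlined `let H` is `spinTwistedHubbardTorus L U` by `rfl`.
Together with the landed converse `stub_swapParityZeroVsPi` the crux is equivalent to
LOCUS ∧ NC1. Longuet-Higgins (1975); Hatsugai (2006). [folklore] -/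
theorem nodalDiracWeakCoupling_of_locusParity :
    (∀ U₀ : ℝ, 0 < U₀ → ∃ U ∈ Set.Ioo (0 : ℝ) U₀, ∃ δ ∈ Set.Icc (1 / 10 : ℝ) (3 / 10),
      ∃ κ : ℝ, 0 < κ ∧ κ < Real.pi ∧ Real.cos κ ≠ 0 ∧ ∀ ε : ℝ, 0 < ε → ∃ L₀ : ℕ,
        ∀ (L : ℕ) [NeZero L], Even L → L₀ ≤ L → (∀ m : ℤ, ε ≤ |L * κ - m * Real.pi|) →
          ∃ c : ℝ, 0 < c ∧ c < Real.pi ∧ |Real.cos c - Real.cos (L * κ)| ≤ ε ∧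
            (∀ φ : Fin 2 → ℝ, 0 ≤ φ 1 → φ 1 ≤ φ 0 → φ 0 ≤ Real.pi →
                ((∃ ψ₁ ψ₂ : Fock (Orb (FermionTorus 2 L)),
                    IsGroundStateInSector (spinTwistedHubbardTorus L U φ) (2 * ⌊(1 - δ) * (L : ℝ) ^ 2 / 2⌋₊) 0 ψ₁ ∧
                    IsGroundStateInSector (spinTwistedHubbardTorus L U φ) (2 * ⌊(1 - δ) * (L : ℝ) ^ 2 / 2⌋₊) 0 ψ₂ ∧
                    star ψ₁ ⬝ᵥ ψ₂ = 0) ↔ (φ 0 = c ∧ φ 1 = c))) ∧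
            (∃ χ₀ χπ : Fock (Orb (FermionTorus 2 L)),
                IsGroundStateInSector (spinTwistedHubbardTorus L U (fun _ : Fin 2 => (0 : ℝ))) (2 * ⌊(1 - δ) * (L : ℝ) ^ 2 / 2⌋₊) 0 χ₀ ∧
                IsGroundStateInSector (spinTwistedHubbardTorus L U (fun _ : Fin 2 => Real.pi)) (2 * ⌊(1 - δ) * (L : ℝ) ^ 2 / 2⌋₊) 0 χπ ∧
                (((@fockD4 L _ (DihedralGroup.sr 3)).val *ᵥ χ₀ = χ₀ ∧
                    (@fockD4 L _ (DihedralGroup.sr 3)).val *ᵥ χπ = -χπ) ∨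
                  ((@fockD4 L _ (DihedralGroup.sr 3)).val *ᵥ χ₀ = -χ₀ ∧
                    (@fockD4 L _ (DihedralGroup.sr 3)).val *ᵥ χπ = χπ)))) →
    NodalDiracWeakCoupling := by
  intro hLP U₀ hU₀
  obtain ⟨U, hU, δ, hδ, κ, hκ0, hκπ, hcos, hε⟩ := hLP U₀ hU₀
  refine ⟨U, hU, δ, hδ, κ, hκ0, hκπ, hcos, fun ε hε0 => ?_⟩
  obtain ⟨L₀, hL⟩ := hε ε hε0
  refine ⟨L₀, fun L _ hEven hL₀ hres => ?_⟩
  obtain ⟨c, hc0, hcπ, hcc, hlocusT, hNC1⟩ := hL L hEven hL₀ hres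
  have hlocus := locus_cell_of_triangle L U _ c hlocusT
  -- the route's inlined `let H` is `spinTwistedHubbardTorus L U` by `rfl`
  exact ⟨c, hc0, hcπ, hcc, hlocus, sign_from_parity L U _ hc0 hcπ hlocus hNC1⟩

end Summit.HubbardSuperconductivity.HubbardSuperconductivity.Theorems.NodalDiracTwist
end
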